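import Summits.QuantumFields.YangMills.Theorems.BalabanUVNodesN11CondExpOfFibrewiseIdentity

/-!
# DAG node N11 — THE FROZEN-`y` FIBREWISE IDENTITY FROM THE WEAK IDENTITY: the converse of dag-n11-d's Fubini reduction —
# «(hweak) for every bounded measurable test of the presented point (y, v₂)» ⟹ «for a.e. retained y and EVERY bounded measurable test of the new variables v₂ alone, (hfib)»

HEADER — WORK-UNIT METADATA.  Cell `pub-ymgap`, YM-PLAN Track A (HUMAN RULING D-0062), seat `pub-ymgap-dag-n11-e` (g23; R134 fan-out seat N11 [B14], strategy s3), route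
`BalabanUVNodes`, item K1⁹ `StabilityBRunRowsAtRecordR13SepCoPHV` = stmt-QuantumFields-27364 (helper lane, `--kind proof --supports 27364 --as helper`, count-neutral).
[I] = [Balaban1987RG1], [III] = [Balaban1988Convergent].  FILE 1 of 3 (generic measure theory; FILE 2 `…N11CondExpFibreSections` = the sections of def-T's skew conditional
expectation ARE the fibre transports + record letters; FILE 3 `…N11CondExpFibreSectionsOmega` = 11a's generation letters, the `↔` with dag-n11-d's names, the witness).
Over dag-n11-d g17's p649025 `…N11CondExpOfFibrewiseIdentity` (`weak_of_fibrewise[_of_nonneg]`, `integrable_candidate_of_fibrewise`).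

WHY THIS FILE.  dag-n11-d's (O3′) road displays, per old branch, ONE identity in three successive currencies: (hce₀) «def-T's skew conditional expectation
`kernelTransport μ_in μ_out skew (piece ∘ e⁻¹)` IS `R̃` a.e.» ⟸ (hweak) «∫ piece(e⁻¹ q)·f(q.1, φ q) dμ_in = ∫ R̃·f dμ_out for every bounded measurable `f` of the presented point»
⟸ (hfib) «for a.e. retained configuration `y` and every bounded measurable `h` OF THE NEW VARIABLES ALONE, ∫ piece(e⁻¹(y,u))·h(φ(y,u)) du = ∫ R̃(y,v)·h(v) dv» — the last being
the SHAPE of print's computation ([III] (3.10)–(3.25): the retained variables `U|_{B_k(Ω^c_{k+1})}` FROZEN).  THIS FILE proves the converse (hweak) ⟹ (hfib), so that the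
three displayed forms are EQUIVALENT and nothing is lost or gained by either reduction.  The content is one measure-theoretic point: from (hweak), Fubini gives, for EACH test
`h`, the fibre identity for a.e. `y` — with an exceptional set depending on `h`; ONE null set serving every bounded measurable `h` is obtained from the COUNTABLE family of
rational half-lines `e⁻¹(Iic q)` of Mathlib's `embeddingReal V` of the standard Borel space of new variables (dag-n08-w2's technique in `…N11CondLawInFibreChart` §3) and the
uniqueness of finite measures on a generating π-system (`ext_of_generate_finite`), applied to the Jordan pieces `φ_*(ρ⁺ν) + R⁻μ₂` and `R⁺μ₂ + φ_*(ρ⁻ν)` (signed `ρ`, `R` allowed).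

WHAT THIS FILE PROVES (0 `def`, 0 `sorry`, standard axioms; generic measurable spaces `Y`, `U`, `V` with `V` standard Borel where stated).
§0 (one fibre) `forall_integral_mul_comp_eq_of_rat` (a pairing identity `∫ ρ·h∘φ dν = ∫ R·h dμ₂` tested on the rational half-lines and on `univ` holds for every bounded
   measurable `h`) + two private `withDensity`/`map` evaluations.
§1 ★ `integrable_candidate_of_weak` (a nonnegative measurable candidate satisfying (hweak) is integrable; truncation + monotone convergence) · ★ `ae_pairing_eq_of_weak` ((hweak) read
   on ONE test of the new variables, a.e. in `y`) · ★★ `fibrewise_of_weak` (THE CONVERSE, candidate integrable) · ★★ `fibrewise_of_weak_of_nonneg` · ★★ `fibrewise_iff_weak` ·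
   ★★ `fibrewise_iff_weak_of_nonneg` (the `↔` with dag-n11-d's `weak_of_fibrewise[_of_nonneg]` BY NAME).

HONEST FRAMING.  Helper lane of K1⁹; count-neutral; [folklore] measure theory (Fubini, `ae_eq_of_forall_setIntegral_eq`, a countable π-system through `embeddingReal`, Jordan
decomposition via `ENNReal.ofReal`) — nothing of Bałaban's ([I] §2, [III] Thm 2) is asserted; (hfib)/(hweak)/(hce₀) remain DISPLAYED where dag-n11-d displays them; (O3′) NOT
closed; N11 NOT discharged; K1⁹ NOT closed, no registered stub touched; counts unmoved (typed 28∕28 · discharged 5∕27 · A 5∕28).  One finite `𝕋⁴_{L^K}` programme at fixed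
`ε = L^{−K}`; R4 closes only the conditional finite-𝕋⁴ rung `BalabanLadder.UV` — NOT ℝ⁴, NOT OS, NOT a mass gap, NOT Clay.  No `sorry`, `axiom`, `def`, `instance`, `notation`.
Sources (SHAPE only): [III] (2.21) p.258, (3.1) p.264, (3.10)–(3.11) p.266, (3.12)–(3.14) p.267, (3.23)–(3.25) p.270; [I] (0.4) p.253, §2 p.267.
-/

noncomputable section

open MeasureTheory ProbabilityTheory
open scoped ENNReal NNReal BigOperators

namespace Summit.QuantumFields.YangMills.Theorems.BalabanUVNodesN11FibrewiseOfWeakIdentity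

open Literature.MathematicalPhysics.QuantumFieldTheory.Balaban1983to89
open BalabanUVNodesN11CondExpOfFibrewiseIdentity (weak_of_fibrewise weak_of_fibrewise_of_nonneg integrable_candidate_of_fibrewise)

/-! ## §0  One fibre: a pairing identity tested on the rational half-lines of a real embedding holds for every bounded measurable test -/

section Fibre

variable {U V : Type*} [MeasurableSpace U] [MeasurableSpace V]

/-- The positive part of an integrable real density, pushed forward along a measurable `φ`, charges a measurable set `s` with `∫ ρ⁺·𝟙ₛ∘φ`. [folklore] -/
private theorem map_withDensity_ofReal_apply (ν : Measure U) {ρ : U → ℝ} (hρ : Integrable ρ ν) {φ : U → V} (hφ : Measurable φ)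
    {s : Set V} (hs : MeasurableSet s) :
    ((ν.withDensity fun u => ENNReal.ofReal (ρ u)).map φ) s =
      ENNReal.ofReal (∫ u, max (ρ u) 0 * s.indicator (fun _ => (1 : ℝ)) (φ u) ∂ν) := by
  rw [Measure.map_apply hφ hs, withDensity_apply _ (hφ hs)]
  have h1 : (fun u => max (ρ u) 0 * s.indicator (fun _ => (1 : ℝ)) (φ u)) = (φ ⁻¹' s).indicator (fun u => max (ρ u) 0) := by
    funext u
    by_cases hu : φ u ∈ s
    · rw [Set.indicator_of_mem hu, mul_one, Set.indicator_of_mem (show u ∈ φ ⁻¹' s from hu)]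
    · rw [Set.indicator_of_notMem hu, mul_zero, Set.indicator_of_notMem (show u ∉ φ ⁻¹' s from hu)]
  rw [h1, integral_indicator (hφ hs),
    ofReal_integral_eq_lintegral_ofReal hρ.pos_part.restrict (ae_of_all _ fun u => le_max_right _ _)]
  refine lintegral_congr fun u => ?_
  rcases le_total (ρ u) 0 with h | h
  · rw [max_eq_right h, ENNReal.ofReal_zero, ENNReal.ofReal_of_nonpos h]
  · rw [max_eq_left h]

/-- Integration of a measurable test function against the pushed-forward positive part: `∫ h d(φ_*(ρ⁺ν)) = ∫ ρ⁺·h∘φ dν`. [folklore] -/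
private theorem integral_map_withDensity_ofReal (ν : Measure U) {ρ : U → ℝ} (hρ : Integrable ρ ν) {φ : U → V} (hφ : Measurable φ)
    {h : V → ℝ} (hh : Measurable h) :
    ∫ v, h v ∂((ν.withDensity fun u => ENNReal.ofReal (ρ u)).map φ) = ∫ u, max (ρ u) 0 * h (φ u) ∂ν := by
  rw [integral_map hφ.aemeasurable hh.aestronglyMeasurable,
    integral_withDensity_eq_integral_toReal_smul₀ hρ.1.aemeasurable.ennreal_ofReal (ae_of_all _ fun _ => ENNReal.ofReal_lt_top)]
  refine integral_congr_ae (ae_of_all _ fun u => ?_)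
  show (ENNReal.ofReal (ρ u)).toReal • h (φ u) = max (ρ u) 0 * h (φ u)
  rw [ENNReal.toReal_ofReal', smul_eq_mul]

/-- **ONE FIBRE.**  For `ν`-integrable `ρ : U → ℝ`, `μ₂`-integrable `R : V → ℝ` (`V` standard Borel, `e := embeddingReal V`) and measurable `φ : U → V`: if the pairing identity
`∫ ρ·𝟙ₛ∘φ dν = ∫ R·𝟙ₛ dμ₂` holds on the rational half-lines `s = e⁻¹(Iic q)` and on `s = univ`, it holds for EVERY bounded measurable test `h : V → ℝ`
(Jordan decomposition: the finite measures `φ_*(ρ⁺ν) + R⁻μ₂` and `R⁺μ₂ + φ_*(ρ⁻ν)` agree on a generating π-system, `ext_of_generate_finite`). [folklore] -/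
theorem forall_integral_mul_comp_eq_of_rat [StandardBorelSpace V] (ν : Measure U) (μ₂ : Measure V)
    {ρ : U → ℝ} (hρ : Integrable ρ ν) {φ : U → V} (hφ : Measurable φ) {R : V → ℝ} (hR : Integrable R μ₂)
    (hrat : ∀ q : ℚ, ∫ u, ρ u * (embeddingReal V ⁻¹' Set.Iic (q : ℝ)).indicator (fun _ => (1 : ℝ)) (φ u) ∂ν =
      ∫ v, R v * (embeddingReal V ⁻¹' Set.Iic (q : ℝ)).indicator (fun _ => (1 : ℝ)) v ∂μ₂)
    (huniv : ∫ u, ρ u ∂ν = ∫ v, R v ∂μ₂)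
    (h : V → ℝ) (hh : Measurable h) (hC : ∃ C : ℝ, ∀ v, |h v| ≤ C) :
    ∫ u, ρ u * h (φ u) ∂ν = ∫ v, R v * h v ∂μ₂ := by
  obtain ⟨C, hC⟩ := hC
  set e : V → ℝ := embeddingReal V with he_def
  have he : MeasurableEmbedding e := measurableEmbedding_embeddingReal V
  -- the four finite measures of the Jordan decomposition
  set A₁ : Measure V := (ν.withDensity fun u => ENNReal.ofReal (ρ u)).map φ with hA₁
  set A₂ : Measure V := (ν.withDensity fun u => ENNReal.ofReal (-ρ u)).map φ with hA₂
  set B₁ : Measure V := μ₂.withDensity fun v => ENNReal.ofReal (R v) with hB₁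
  set B₂ : Measure V := μ₂.withDensity fun v => ENNReal.ofReal (-R v) with hB₂
  haveI : IsFiniteMeasure (ν.withDensity fun u => ENNReal.ofReal (ρ u)) := isFiniteMeasure_withDensity_ofReal hρ.2
  haveI : IsFiniteMeasure (ν.withDensity fun u => ENNReal.ofReal (-ρ u)) := isFiniteMeasure_withDensity_ofReal hρ.neg.2
  haveI : IsFiniteMeasure B₁ := isFiniteMeasure_withDensity_ofReal hR.2
  haveI : IsFiniteMeasure B₂ := isFiniteMeasure_withDensity_ofReal hR.neg.2
  haveI : IsFiniteMeasure A₁ := by rw [hA₁]; infer_instance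
  haveI : IsFiniteMeasure A₂ := by rw [hA₂]; infer_instance
  have hρn : Integrable (fun u => -ρ u) ν := hρ.neg
  have hRn : Integrable (fun v => -R v) μ₂ := hR.neg
  -- the real pairing identity on a set gives agreement of `A₁ + B₂` and `B₁ + A₂` there
  have key : ∀ s : Set V, MeasurableSet s →
      ∫ u, ρ u * s.indicator (fun _ => (1 : ℝ)) (φ u) ∂ν = ∫ v, R v * s.indicator (fun _ => (1 : ℝ)) v ∂μ₂ →
      (A₁ + B₂) s = (B₁ + A₂) s := by
    intro s hs hI
    have hind : Measurable (s.indicator fun _ => (1 : ℝ)) := measurable_const.indicator hs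
    have hbd : ∀ v, ‖s.indicator (fun _ => (1 : ℝ)) v‖ ≤ 1 := fun v => by
      by_cases hv : v ∈ s <;> simp [hv]
    have iρp : Integrable (fun u => max (ρ u) 0 * s.indicator (fun _ => (1 : ℝ)) (φ u)) ν :=
      hρ.pos_part.mul_bdd (hind.comp hφ).aestronglyMeasurable (ae_of_all _ fun u => hbd (φ u))
    have iρn : Integrable (fun u => max (-ρ u) 0 * s.indicator (fun _ => (1 : ℝ)) (φ u)) ν :=
      hρ.neg_part.mul_bdd (hind.comp hφ).aestronglyMeasurable (ae_of_all _ fun u => hbd (φ u))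
    have iRp : Integrable (fun v => max (R v) 0 * s.indicator (fun _ => (1 : ℝ)) v) μ₂ :=
      hR.pos_part.mul_bdd hind.aestronglyMeasurable (ae_of_all _ fun v => hbd v)
    have iRn : Integrable (fun v => max (-R v) 0 * s.indicator (fun _ => (1 : ℝ)) v) μ₂ :=
      hR.neg_part.mul_bdd hind.aestronglyMeasurable (ae_of_all _ fun v => hbd v)
    have h1 : ∫ u, ρ u * s.indicator (fun _ => (1 : ℝ)) (φ u) ∂ν =
        ∫ u, max (ρ u) 0 * s.indicator (fun _ => (1 : ℝ)) (φ u) ∂ν - ∫ u, max (-ρ u) 0 * s.indicator (fun _ => (1 : ℝ)) (φ u) ∂ν := by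
      rw [← integral_sub iρp iρn]
      exact integral_congr_ae (ae_of_all _ fun u => by dsimp only; rw [← sub_mul, max_zero_sub_max_neg_zero_eq_self])
    have h2 : ∫ v, R v * s.indicator (fun _ => (1 : ℝ)) v ∂μ₂ =
        ∫ v, max (R v) 0 * s.indicator (fun _ => (1 : ℝ)) v ∂μ₂ - ∫ v, max (-R v) 0 * s.indicator (fun _ => (1 : ℝ)) v ∂μ₂ := by
      rw [← integral_sub iRp iRn]
      exact integral_congr_ae (ae_of_all _ fun v => by dsimp only; rw [← sub_mul, max_zero_sub_max_neg_zero_eq_self])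
    have hI' : ∫ u, max (ρ u) 0 * s.indicator (fun _ => (1 : ℝ)) (φ u) ∂ν + ∫ v, max (-R v) 0 * s.indicator (fun _ => (1 : ℝ)) v ∂μ₂ =
        ∫ v, max (R v) 0 * s.indicator (fun _ => (1 : ℝ)) v ∂μ₂ + ∫ u, max (-ρ u) 0 * s.indicator (fun _ => (1 : ℝ)) (φ u) ∂ν := by
      rw [h1, h2] at hI
      linarith
    have n1 : 0 ≤ ∫ u, max (ρ u) 0 * s.indicator (fun _ => (1 : ℝ)) (φ u) ∂ν :=
      integral_nonneg fun u => mul_nonneg (le_max_right _ _) (Set.indicator_nonneg (fun _ _ => zero_le_one) _)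
    have n2 : 0 ≤ ∫ v, max (-R v) 0 * s.indicator (fun _ => (1 : ℝ)) v ∂μ₂ :=
      integral_nonneg fun v => mul_nonneg (le_max_right _ _) (Set.indicator_nonneg (fun _ _ => zero_le_one) _)
    have n3 : 0 ≤ ∫ v, max (R v) 0 * s.indicator (fun _ => (1 : ℝ)) v ∂μ₂ :=
      integral_nonneg fun v => mul_nonneg (le_max_right _ _) (Set.indicator_nonneg (fun _ _ => zero_le_one) _)
    have n4 : 0 ≤ ∫ u, max (-ρ u) 0 * s.indicator (fun _ => (1 : ℝ)) (φ u) ∂ν :=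
      integral_nonneg fun u => mul_nonneg (le_max_right _ _) (Set.indicator_nonneg (fun _ _ => zero_le_one) _)
    have a1 : A₁ s = ENNReal.ofReal (∫ u, max (ρ u) 0 * s.indicator (fun _ => (1 : ℝ)) (φ u) ∂ν) :=
      map_withDensity_ofReal_apply ν hρ hφ hs
    have a2 : A₂ s = ENNReal.ofReal (∫ u, max (-ρ u) 0 * s.indicator (fun _ => (1 : ℝ)) (φ u) ∂ν) :=
      map_withDensity_ofReal_apply ν hρn hφ hs
    have b1 : B₁ s = ENNReal.ofReal (∫ v, max (R v) 0 * s.indicator (fun _ => (1 : ℝ)) v ∂μ₂) := by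
      have h := map_withDensity_ofReal_apply μ₂ hR measurable_id hs
      rwa [Measure.map_id] at h
    have b2 : B₂ s = ENNReal.ofReal (∫ v, max (-R v) 0 * s.indicator (fun _ => (1 : ℝ)) v ∂μ₂) := by
      have h := map_withDensity_ofReal_apply μ₂ hRn measurable_id hs
      rwa [Measure.map_id] at h
    rw [Measure.add_apply, Measure.add_apply, a1, a2, b1, b2, ← ENNReal.ofReal_add n1 n2, ← ENNReal.ofReal_add n3 n4, hI']
  -- agreement on the rational half-lines and on `univ`, hence everywhere
  have huniv' : ∫ u, ρ u * Set.univ.indicator (fun _ => (1 : ℝ)) (φ u) ∂ν = ∫ v, R v * Set.univ.indicator (fun _ => (1 : ℝ)) v ∂μ₂ := by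
    simpa only [Set.indicator_univ, mul_one] using huniv
  have hmap : (A₁ + B₂).map e = (B₁ + A₂).map e := by
    refine ext_of_generate_finite (⋃ a : ℚ, {Set.Iic (a : ℝ)}) Real.borel_eq_generateFrom_Iic_rat Real.isPiSystem_Iic_rat ?_ ?_
    · intro s hs
      obtain ⟨q, hq⟩ := Set.mem_iUnion.1 hs
      rw [Set.mem_singleton_iff] at hq
      rw [hq, he.map_apply, he.map_apply]
      exact key _ (he.measurable measurableSet_Iic) (hrat q)
    · rw [he.map_apply, he.map_apply, Set.preimage_univ]
      exact key _ MeasurableSet.univ huniv'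
  have heq : A₁ + B₂ = B₁ + A₂ := by
    ext s hs
    have h := congrArg (fun m : Measure ℝ => m (e '' s)) hmap
    simp only [he.map_apply, he.injective.preimage_image] at h
    exact h
  -- integrate the bounded measurable test against the two equal measures
  have hbd' : ∀ v, ‖h v‖ ≤ C := fun v => by simpa [Real.norm_eq_abs] using hC v
  have hint : ∀ (m : Measure V) [IsFiniteMeasure m], Integrable h m := fun m _ =>
    Integrable.of_bound (C := C) hh.aestronglyMeasurable (ae_of_all _ hbd')
  have h4 : ∫ v, h v ∂(A₁ + B₂) = ∫ v, h v ∂(B₁ + A₂) := by rw [heq]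
  rw [integral_add_measure (hint A₁) (hint B₂), integral_add_measure (hint B₁) (hint A₂)] at h4
  have a1 : ∫ v, h v ∂A₁ = ∫ u, max (ρ u) 0 * h (φ u) ∂ν := integral_map_withDensity_ofReal ν hρ hφ hh
  have a2 : ∫ v, h v ∂A₂ = ∫ u, max (-ρ u) 0 * h (φ u) ∂ν := integral_map_withDensity_ofReal ν hρn hφ hh
  have b1 : ∫ v, h v ∂B₁ = ∫ v, max (R v) 0 * h v ∂μ₂ := by
    have h := integral_map_withDensity_ofReal μ₂ hR measurable_id hh
    rwa [Measure.map_id] at h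
  have b2 : ∫ v, h v ∂B₂ = ∫ v, max (-R v) 0 * h v ∂μ₂ := by
    have h := integral_map_withDensity_ofReal μ₂ hRn measurable_id hh
    rwa [Measure.map_id] at h
  rw [a1, a2, b1, b2] at h4
  have iρp : Integrable (fun u => max (ρ u) 0 * h (φ u)) ν := hρ.pos_part.mul_bdd (hh.comp hφ).aestronglyMeasurable (ae_of_all _ fun u => hbd' (φ u))
  have iρn : Integrable (fun u => max (-ρ u) 0 * h (φ u)) ν := hρ.neg_part.mul_bdd (hh.comp hφ).aestronglyMeasurable (ae_of_all _ fun u => hbd' (φ u))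
  have iRp : Integrable (fun v => max (R v) 0 * h v) μ₂ := hR.pos_part.mul_bdd hh.aestronglyMeasurable (ae_of_all _ hbd')
  have iRn : Integrable (fun v => max (-R v) 0 * h v) μ₂ := hR.neg_part.mul_bdd hh.aestronglyMeasurable (ae_of_all _ hbd')
  have e1 : ∫ u, ρ u * h (φ u) ∂ν = ∫ u, max (ρ u) 0 * h (φ u) ∂ν - ∫ u, max (-ρ u) 0 * h (φ u) ∂ν := by
    rw [← integral_sub iρp iρn]
    exact integral_congr_ae (ae_of_all _ fun u => by dsimp only; rw [← sub_mul, max_zero_sub_max_neg_zero_eq_self])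
  have e2 : ∫ v, R v * h v ∂μ₂ = ∫ v, max (R v) 0 * h v ∂μ₂ - ∫ v, max (-R v) 0 * h v ∂μ₂ := by
    rw [← integral_sub iRp iRn]
    exact integral_congr_ae (ae_of_all _ fun v => by dsimp only; rw [← sub_mul, max_zero_sub_max_neg_zero_eq_self])
  rw [e1, e2]
  linarith

end Fibre

/-! ## §1  Generic: the converse Fubini reduction, and the sections of the skew conditional expectation -/

section Generic

variable {Y U V : Type*} [MeasurableSpace Y] [MeasurableSpace U] [MeasurableSpace V]

/-- ★ **INTEGRABILITY OF A NONNEGATIVE MEASURABLE CANDIDATE FROM THE WEAK IDENTITY**: if `ρ` is `μy ⊗ ν`-integrable, `R ≥ 0` is measurable and the weak identity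
`∫ ρ(q)·f(q.1, φ q) d(μy ⊗ ν) = ∫ R(z)·f(z) d(μy ⊗ μ₂)` holds for every bounded measurable `f`, then `R` is `μy ⊗ μ₂`-integrable (test with `𝟙{R ≤ n}`: the truncated integrals are
bounded by `∫ |ρ|`; monotone convergence; `μy`, `μ₂` finite). [folklore] -/
theorem integrable_candidate_of_weak (μy : Measure Y) [IsFiniteMeasure μy] (ν : Measure U) [SFinite ν] (μ₂ : Measure V) [IsFiniteMeasure μ₂]
    {ρ : Y × U → ℝ} (hρ : Integrable ρ (μy.prod ν)) {φ : Y × U → V} (hφ : Measurable φ)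
    {R : Y × V → ℝ} (hR0 : ∀ z, 0 ≤ R z) (hRm : Measurable R)
    (hweak : ∀ f : Y × V → ℝ, Measurable f → (∃ C : ℝ, ∀ z, |f z| ≤ C) →
      ∫ q, ρ q * f (q.1, φ q) ∂(μy.prod ν) = ∫ z, R z * f z ∂(μy.prod μ₂)) :
    Integrable R (μy.prod μ₂) := by
  refine ⟨hRm.aestronglyMeasurable, ?_⟩
  have hS : ∀ n : ℕ, MeasurableSet {z : Y × V | R z ≤ (n : ℝ)} := fun n => hRm measurableSet_Iic
  -- the truncated integrals are bounded by `∫ |ρ|`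
  have hbd : ∀ n : ℕ, ∫ z, {z : Y × V | R z ≤ (n : ℝ)}.indicator R z ∂(μy.prod μ₂) ≤ ∫ q, |ρ q| ∂(μy.prod ν) := by
    intro n
    have hind : Measurable ({z : Y × V | R z ≤ (n : ℝ)}.indicator fun _ => (1 : ℝ)) := measurable_const.indicator (hS n)
    have hind_bdd : ∀ z, |{z : Y × V | R z ≤ (n : ℝ)}.indicator (fun _ => (1 : ℝ)) z| ≤ 1 := fun z => by
      by_cases hz : z ∈ {z : Y × V | R z ≤ (n : ℝ)} <;> simp [hz]
    have h1 := hweak _ hind ⟨1, hind_bdd⟩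
    have h2 : (fun z => R z * {z : Y × V | R z ≤ (n : ℝ)}.indicator (fun _ => (1 : ℝ)) z) = {z : Y × V | R z ≤ (n : ℝ)}.indicator R := by
      funext z
      by_cases hz : z ∈ {z : Y × V | R z ≤ (n : ℝ)}
      · rw [Set.indicator_of_mem hz, Set.indicator_of_mem hz, mul_one]
      · rw [Set.indicator_of_notMem hz, Set.indicator_of_notMem hz, mul_zero]
    rw [← h2, ← h1]
    have hI : Integrable (fun q : Y × U => ρ q * {z : Y × V | R z ≤ (n : ℝ)}.indicator (fun _ => (1 : ℝ)) (q.1, φ q)) (μy.prod ν) :=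
      hρ.mul_bdd (hind.comp (measurable_fst.prodMk hφ)).aestronglyMeasurable
        (Filter.Eventually.of_forall fun q => by simpa [Real.norm_eq_abs] using hind_bdd (q.1, φ q))
    refine integral_mono hI hρ.abs fun q => ?_
    dsimp only
    by_cases hq : (q.1, φ q) ∈ {z : Y × V | R z ≤ (n : ℝ)}
    · rw [Set.indicator_of_mem hq, mul_one]; exact le_abs_self _
    · rw [Set.indicator_of_notMem hq, mul_zero]; exact abs_nonneg _
  -- monotone convergence
  have hmeas : ∀ n : ℕ, Measurable fun z => ENNReal.ofReal ({z : Y × V | R z ≤ (n : ℝ)}.indicator R z) :=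
    fun n => (hRm.indicator (hS n)).ennreal_ofReal
  have hmono : Monotone fun (n : ℕ) (z : Y × V) => ENNReal.ofReal ({z : Y × V | R z ≤ (n : ℝ)}.indicator R z) := by
    intro n m hnm z
    refine ENNReal.ofReal_le_ofReal (Set.indicator_le_indicator_of_subset (fun z (hz : R z ≤ (n : ℝ)) => ?_) (fun _ => hR0 _) z)
    exact hz.trans (by exact_mod_cast hnm)
  have hsup : ∀ z, (⨆ n : ℕ, ENNReal.ofReal ({z : Y × V | R z ≤ (n : ℝ)}.indicator R z)) = ‖R z‖ₑ := by
    intro z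
    rw [Real.enorm_eq_ofReal (hR0 _)]
    refine le_antisymm (iSup_le fun n => ENNReal.ofReal_le_ofReal (Set.indicator_le_self' (fun _ _ => hR0 _) z)) ?_
    obtain ⟨n, hn⟩ := exists_nat_ge (R z)
    refine le_iSup_of_le n (le_of_eq ?_)
    rw [Set.indicator_of_mem (show z ∈ {z : Y × V | R z ≤ (n : ℝ)} from hn)]
  have hlin : ∫⁻ z, ‖R z‖ₑ ∂(μy.prod μ₂) = ⨆ n : ℕ, ∫⁻ z, ENNReal.ofReal ({z : Y × V | R z ≤ (n : ℝ)}.indicator R z) ∂(μy.prod μ₂) := by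
    rw [← lintegral_iSup hmeas hmono]
    exact lintegral_congr fun z => (hsup z).symm
  show ∫⁻ z, ‖R z‖ₑ ∂(μy.prod μ₂) < ∞
  rw [hlin]
  refine lt_of_le_of_lt (iSup_le fun n => ?_) (ENNReal.ofReal_lt_top (r := ∫ q, |ρ q| ∂(μy.prod ν)))
  have hIn : Integrable ({z : Y × V | R z ≤ (n : ℝ)}.indicator R) (μy.prod μ₂) := by
    refine Integrable.of_bound (C := (n : ℝ)) (hRm.indicator (hS n)).aestronglyMeasurable (Filter.Eventually.of_forall fun z => ?_)
    by_cases hz : z ∈ {z : Y × V | R z ≤ (n : ℝ)}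
    · have hz' : R z ≤ n := hz
      rw [Set.indicator_of_mem hz, Real.norm_eq_abs, abs_of_nonneg (hR0 _)]; exact hz'
    · rw [Set.indicator_of_notMem hz, norm_zero]; exact Nat.cast_nonneg n
  rw [← ofReal_integral_eq_lintegral_ofReal hIn (Filter.Eventually.of_forall fun z => Set.indicator_nonneg (fun _ _ => hR0 _) z)]
  exact ENNReal.ofReal_le_ofReal (hbd n)

/-- ★ **THE WEAK IDENTITY READ ON ONE TEST OF THE NEW VARIABLES, `μy`-a.e.**: for every bounded measurable `h : V → ℝ`, the fibre pairings
`y ↦ ∫ ρ(y,u)·h(φ(y,u)) dν` and `y ↦ ∫ R(y,v)·h(v) dμ₂` agree `μy`-a.e. (test the weak identity with `𝟙_B(y)·h(v)` for every measurable `B ⊆ Y`, Fubini, then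
`ae_eq_of_forall_setIntegral_eq`).  The exceptional set depends on `h`. [folklore] -/
theorem ae_pairing_eq_of_weak (μy : Measure Y) [SFinite μy] (ν : Measure U) [SFinite ν] (μ₂ : Measure V) [SFinite μ₂]
    {ρ : Y × U → ℝ} (hρ : Integrable ρ (μy.prod ν)) {φ : Y × U → V} (hφ : Measurable φ)
    {R : Y × V → ℝ} (hRint : Integrable R (μy.prod μ₂))
    (hweak : ∀ f : Y × V → ℝ, Measurable f → (∃ C : ℝ, ∀ z, |f z| ≤ C) →
      ∫ q, ρ q * f (q.1, φ q) ∂(μy.prod ν) = ∫ z, R z * f z ∂(μy.prod μ₂))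
    {h : V → ℝ} (hh : Measurable h) (hC : ∃ C : ℝ, ∀ v, |h v| ≤ C) :
    (fun y => ∫ u, ρ (y, u) * h (φ (y, u)) ∂ν) =ᵐ[μy] fun y => ∫ v, R (y, v) * h v ∂μ₂ := by
  obtain ⟨C, hC⟩ := hC
  have hbd : ∀ v, ‖h v‖ ≤ C := fun v => by simpa [Real.norm_eq_abs] using hC v
  have hI1 : Integrable (fun q : Y × U => ρ q * h (φ q)) (μy.prod ν) :=
    hρ.mul_bdd (hh.comp hφ).aestronglyMeasurable (Filter.Eventually.of_forall fun q => hbd (φ q))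
  have hI2 : Integrable (fun z : Y × V => R z * h z.2) (μy.prod μ₂) :=
    hRint.mul_bdd (hh.comp measurable_snd).aestronglyMeasurable (Filter.Eventually.of_forall fun z => hbd z.2)
  refine Integrable.ae_eq_of_forall_setIntegral_eq _ _ hI1.integral_prod_left hI2.integral_prod_left fun B hB _ => ?_
  -- test with `𝟙_B(y)·h(v)`
  have hf : Measurable fun z : Y × V => B.indicator (fun _ => (1 : ℝ)) z.1 * h z.2 :=
    ((measurable_const.indicator hB).comp measurable_fst).mul (hh.comp measurable_snd)
  have hfC : ∃ C' : ℝ, ∀ z : Y × V, |B.indicator (fun _ => (1 : ℝ)) z.1 * h z.2| ≤ C' := by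
    refine ⟨C, fun z => ?_⟩
    rw [abs_mul]
    by_cases hz : z.1 ∈ B
    · rw [Set.indicator_of_mem hz, abs_one, one_mul]; exact hC z.2
    · rw [Set.indicator_of_notMem hz, abs_zero, zero_mul]; exact (abs_nonneg _).trans (hC z.2)
  have key := hweak _ hf hfC
  obtain ⟨C', hC'⟩ := hfC
  have hbd1 : ∀ q : Y × U, ‖B.indicator (fun _ => (1 : ℝ)) (q.1, φ q).1 * h (q.1, φ q).2‖ ≤ C' := fun q => by
    rw [Real.norm_eq_abs]; exact hC' (q.1, φ q)
  have hbd2 : ∀ z : Y × V, ‖B.indicator (fun _ => (1 : ℝ)) z.1 * h z.2‖ ≤ C' := fun z => by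
    rw [Real.norm_eq_abs]; exact hC' z
  have hI1' : Integrable (fun q : Y × U => ρ q * (B.indicator (fun _ => (1 : ℝ)) q.1 * h (φ q))) (μy.prod ν) :=
    hρ.mul_bdd (hf.comp (measurable_fst.prodMk hφ)).aestronglyMeasurable (Filter.Eventually.of_forall hbd1)
  have hI2' : Integrable (fun z : Y × V => R z * (B.indicator (fun _ => (1 : ℝ)) z.1 * h z.2)) (μy.prod μ₂) :=
    hRint.mul_bdd hf.aestronglyMeasurable (Filter.Eventually.of_forall hbd2)
  have e1 : ∫ q, ρ q * (B.indicator (fun _ => (1 : ℝ)) q.1 * h (φ q)) ∂(μy.prod ν) =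
      ∫ y in B, (∫ u, ρ (y, u) * h (φ (y, u)) ∂ν) ∂μy := by
    rw [integral_prod _ hI1', ← integral_indicator hB]
    refine integral_congr_ae (ae_of_all _ fun y => ?_)
    dsimp only
    by_cases hy : y ∈ B
    · rw [Set.indicator_of_mem hy, Set.indicator_of_mem hy]
      exact integral_congr_ae (ae_of_all _ fun u => by dsimp only; rw [one_mul])
    · rw [Set.indicator_of_notMem hy, Set.indicator_of_notMem hy]
      simp only [zero_mul, mul_zero, integral_zero]
  have e2 : ∫ z, R z * (B.indicator (fun _ => (1 : ℝ)) z.1 * h z.2) ∂(μy.prod μ₂) =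
      ∫ y in B, (∫ v, R (y, v) * h v ∂μ₂) ∂μy := by
    rw [integral_prod _ hI2', ← integral_indicator hB]
    refine integral_congr_ae (ae_of_all _ fun y => ?_)
    dsimp only
    by_cases hy : y ∈ B
    · rw [Set.indicator_of_mem hy, Set.indicator_of_mem hy]
      exact integral_congr_ae (ae_of_all _ fun v => by dsimp only; rw [one_mul])
    · rw [Set.indicator_of_notMem hy, Set.indicator_of_notMem hy]
      simp only [zero_mul, mul_zero, integral_zero]
  rw [← e1, ← e2]
  exact key

/-- ★★ **THE CONVERSE OF THE FUBINI REDUCTION**: for `ρ` integrable w.r.t. `μy ⊗ ν`, `φ` measurable, `R` integrable w.r.t. `μy ⊗ μ₂`, `V` standard Borel, the weak identity for every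
bounded measurable `f` of `(y, v)` IMPLIES the frozen-`y` fibrewise identity: for `μy`-a.e. `y` and EVERY bounded measurable `h` of `v` alone,
`∫ ρ(y,u)·h(φ(y,u)) dν = ∫ R(y,v)·h(v) dμ₂` — ONE exceptional null set for all `h` (the countable family of rational half-lines of `embeddingReal V`, §0).
Together with dag-n11-d's `weak_of_fibrewise` the two displayed forms are EQUIVALENT. [folklore] -/
theorem fibrewise_of_weak [StandardBorelSpace V] (μy : Measure Y) [SFinite μy] (ν : Measure U) [SFinite ν] (μ₂ : Measure V) [SFinite μ₂]
    {ρ : Y × U → ℝ} (hρ : Integrable ρ (μy.prod ν)) {φ : Y × U → V} (hφ : Measurable φ)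
    {R : Y × V → ℝ} (hRint : Integrable R (μy.prod μ₂))
    (hweak : ∀ f : Y × V → ℝ, Measurable f → (∃ C : ℝ, ∀ z, |f z| ≤ C) →
      ∫ q, ρ q * f (q.1, φ q) ∂(μy.prod ν) = ∫ z, R z * f z ∂(μy.prod μ₂)) :
    ∀ᵐ y ∂μy, ∀ h : V → ℝ, Measurable h → (∃ C : ℝ, ∀ v, |h v| ≤ C) →
      ∫ u, ρ (y, u) * h (φ (y, u)) ∂ν = ∫ v, R (y, v) * h v ∂μ₂ := by
  have he : MeasurableEmbedding (embeddingReal V) := measurableEmbedding_embeddingReal V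
  have hrat : ∀ᵐ y ∂μy, ∀ q : ℚ,
      ∫ u, ρ (y, u) * (embeddingReal V ⁻¹' Set.Iic (q : ℝ)).indicator (fun _ => (1 : ℝ)) (φ (y, u)) ∂ν =
        ∫ v, R (y, v) * (embeddingReal V ⁻¹' Set.Iic (q : ℝ)).indicator (fun _ => (1 : ℝ)) v ∂μ₂ :=
    ae_all_iff.2 fun q => ae_pairing_eq_of_weak μy ν μ₂ hρ hφ hRint hweak
      (measurable_const.indicator (he.measurable measurableSet_Iic))
      ⟨1, fun v => by by_cases hv : v ∈ embeddingReal V ⁻¹' Set.Iic (q : ℝ) <;> simp [hv]⟩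
  have huniv : ∀ᵐ y ∂μy, ∫ u, ρ (y, u) * (fun _ => (1 : ℝ)) (φ (y, u)) ∂ν = ∫ v, R (y, v) * (fun _ => (1 : ℝ)) v ∂μ₂ :=
    ae_pairing_eq_of_weak μy ν μ₂ hρ hφ hRint hweak measurable_const ⟨1, fun _ => by simp⟩
  filter_upwards [hrat, huniv, hρ.prod_right_ae, hRint.prod_right_ae] with y hq h1 hρy hRy h hh hC
  simp only [mul_one] at h1
  exact forall_integral_mul_comp_eq_of_rat ν μ₂ hρy (hφ.comp measurable_prodMk_left) hRy hq h1 h hh hC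

/-- ★★ **THE CONVERSE, candidate nonnegative and measurable** (integrability of `R` derived by `integrable_candidate_of_weak`) — the exact converse of dag-n11-d's
`weak_of_fibrewise_of_nonneg`. [folklore] -/
theorem fibrewise_of_weak_of_nonneg [StandardBorelSpace V] (μy : Measure Y) [IsFiniteMeasure μy] (ν : Measure U) [SFinite ν] (μ₂ : Measure V) [IsFiniteMeasure μ₂]
    {ρ : Y × U → ℝ} (hρ : Integrable ρ (μy.prod ν)) {φ : Y × U → V} (hφ : Measurable φ)
    {R : Y × V → ℝ} (hR0 : ∀ z, 0 ≤ R z) (hRm : Measurable R)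
    (hweak : ∀ f : Y × V → ℝ, Measurable f → (∃ C : ℝ, ∀ z, |f z| ≤ C) →
      ∫ q, ρ q * f (q.1, φ q) ∂(μy.prod ν) = ∫ z, R z * f z ∂(μy.prod μ₂)) :
    ∀ᵐ y ∂μy, ∀ h : V → ℝ, Measurable h → (∃ C : ℝ, ∀ v, |h v| ≤ C) →
      ∫ u, ρ (y, u) * h (φ (y, u)) ∂ν = ∫ v, R (y, v) * h v ∂μ₂ :=
  fibrewise_of_weak μy ν μ₂ hρ hφ (integrable_candidate_of_weak μy ν μ₂ hρ hφ hR0 hRm hweak) hweak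

/-- ★★ **(hfib) ⟺ (hweak)**, candidate integrable (forward: dag-n11-d's `weak_of_fibrewise`; backward: `fibrewise_of_weak`). [folklore] -/
theorem fibrewise_iff_weak [StandardBorelSpace V] (μy : Measure Y) [SFinite μy] (ν : Measure U) [SFinite ν] (μ₂ : Measure V) [SFinite μ₂]
    {ρ : Y × U → ℝ} (hρ : Integrable ρ (μy.prod ν)) {φ : Y × U → V} (hφ : Measurable φ)
    {R : Y × V → ℝ} (hRint : Integrable R (μy.prod μ₂)) :
    (∀ᵐ y ∂μy, ∀ h : V → ℝ, Measurable h → (∃ C : ℝ, ∀ v, |h v| ≤ C) →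
      ∫ u, ρ (y, u) * h (φ (y, u)) ∂ν = ∫ v, R (y, v) * h v ∂μ₂) ↔
    (∀ f : Y × V → ℝ, Measurable f → (∃ C : ℝ, ∀ z, |f z| ≤ C) →
      ∫ q, ρ q * f (q.1, φ q) ∂(μy.prod ν) = ∫ z, R z * f z ∂(μy.prod μ₂)) :=
  ⟨fun hfib f hf hC => weak_of_fibrewise μy ν μ₂ hρ hφ hRint hfib f hf hC, fibrewise_of_weak μy ν μ₂ hρ hφ hRint⟩

/-- ★★ **(hfib) ⟺ (hweak)**, candidate nonnegative and measurable (`μ₂` finite, as in dag-n11-d's `weak_of_fibrewise_of_nonneg`). [folklore] -/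
theorem fibrewise_iff_weak_of_nonneg [StandardBorelSpace V] (μy : Measure Y) [IsFiniteMeasure μy] (ν : Measure U) [SFinite ν] (μ₂ : Measure V) [IsFiniteMeasure μ₂]
    {ρ : Y × U → ℝ} (hρ : Integrable ρ (μy.prod ν)) {φ : Y × U → V} (hφ : Measurable φ)
    {R : Y × V → ℝ} (hR0 : ∀ z, 0 ≤ R z) (hRm : Measurable R) :
    (∀ᵐ y ∂μy, ∀ h : V → ℝ, Measurable h → (∃ C : ℝ, ∀ v, |h v| ≤ C) →
      ∫ u, ρ (y, u) * h (φ (y, u)) ∂ν = ∫ v, R (y, v) * h v ∂μ₂) ↔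
    (∀ f : Y × V → ℝ, Measurable f → (∃ C : ℝ, ∀ z, |f z| ≤ C) →
      ∫ q, ρ q * f (q.1, φ q) ∂(μy.prod ν) = ∫ z, R z * f z ∂(μy.prod μ₂)) :=
  ⟨fun hfib f hf hC => weak_of_fibrewise_of_nonneg μy ν μ₂ hρ hφ hR0 hRm hfib f hf hC, fibrewise_of_weak_of_nonneg μy ν μ₂ hρ hφ hR0 hRm⟩

end Generic

end Summit.QuantumFields.YangMills.Theorems.BalabanUVNodesN11FibrewiseOfWeakIdentity

end
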